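import Literature.NumberTheory.LFunctions.WeilGroundState
import Literature.NumberTheory.LFunctions.WeilWindowSimpleEven
import HarnessLib

/-!
# Real zeros of the transform of a simple even ground state of the truncated Weil form
# (Connes–van Suijlekom 2025, Thm. 6.1; Connes 2026, §5–§6.1)

Sibling of `Literature/NumberTheory/LFunctions/WeilGroundState.lean` (same normalisation: additive
variable `t = log x`, test functions `IsWeilTest`, `Q(g) = weilQuadratic g = W(g ⋆ g̃)`, ground
energy `ε(a) = weilGroundEnergy a` on the window `[-a, a]`, ground states `IsWeilGroundState a u`,
transform `weilMellin u s = ∫ u(t) e^{(s - 1/2)t} dt`, so that `s = 1/2 + iz` is the Fourier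
variable).

Sources, read verbatim (held texts `paper:arxiv-2511.23257`, `paper:arxiv-2602.04022`):

* A. Connes, W. D. van Suijlekom, *Quadratic Forms, Real Zeros and Echoes of the Spectral Action*,
  Comm. Math. Phys. 406 (2025) = arXiv:2511.23257, **Theorem 6.1** (p. 11): "Let `L > 0`, and let
  `𝒟` be a real distribution on the interval `[0, L]`. Let `Q` be the quadratic form defined on
  trigonometric polynomials by (4.3). Assume that `Q` defines a lower-bounded essentially
  selfadjoint operator and that the minimum of its spectrum is a simple, isolated eigenvalue `λ`,
  with even eigenfunction [invariant under the symmetry `x ↦ L - x` of `[0, L]`] `ξ`. Then all the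
  zeros of the entire function `ξ̂(z)`, `z ∈ ℂ`, the Fourier transform of `ξ` lie on the real
  line." (Proof: trigonometric polynomials are a core; min–max; the finite sections `Q_N` have the
  special form of Prop. 4.1; the finite-dimensional Thm. 5.6; Hurwitz.)
* A. Connes, *The Riemann Hypothesis: Past, Present and a Letter Through Time* (2026),
  arXiv:2602.04022 — the application to WEIL's form on a window (§5, the letter, p. 20; §6.1):
  "It is a quadratic form on the … space of functions `φ(u)` of a positive real variable which
  vanish outside the interval `[1, x]`. The value `Q(φ)` of the quadratic form is obtained by
  applying the explicit formula to the function `ψ(v) = ∫ φ(u)φ(uv)du/u`. … there is a function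
  `η(u)` realizing the minimum of the quadratic form `Q(φ)` while `∫ φ(u)²du/u = 1` [Bombieri's
  Problem 2 / Thm. 3]. I then take the Mellin transform of the function `η(u)`. I also know how to
  prove [§6.1: by the theorem above] that the zeros of this Mellin transform are on the critical
  line. This is proved modulo a condition of uniqueness of the minimum [one needs to assume that
  the lowest eigenvalue of the quadratic form is simple and even]." (§6.1 is titled "The Fourier
  transform of `θ_x` has all its zeros on the real line", `θ_x(u) = η_x(x^{1/2}u)` the recentred
  minimiser on the symmetric window `[x^{-1/2}, x^{1/2}]`, i.e. `[-a, a]` with `a = ½ log x`.)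

## What is here

* `WeilWindowSimpleEven a` — the HYPOTHESIS "the bottom `ε(a)` of the truncated Weil form on
  `[-a, a]` is a simple, isolated eigenvalue with EVEN eigenfunction", stated variationally and
  junk-free exactly as requested by the definition item `WeilWindowSimpleEven` of route
  `RiemannHypothesis/WeilGroundState`: there are a witness `φ` and a gap `δ > 0` such that every
  `L²`-normalised test function on the window that is ODD, or EVEN and orthogonal to `φ`, has
  `Re Q ≥ ε(a) + δ`. (Weil's form is invariant under `g ↦ g(-·)` — the polar, prime and
  archimedean terms are symmetric — so it splits over even ⊕ odd; the condition then says
  `λ₂ ≥ ε(a) + δ` by min–max, i.e. the bottom is a simple isolated eigenvalue, and that the odd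
  sector lies above the gap, i.e. the eigenfunction is even; conversely a simple isolated even
  bottom `ξ` gives the condition with `φ = ξ`.)
* the named fact `Connes2026_weilGroundState_zeros_re_eq_half`: under `WeilWindowSimpleEven a`,
  every ground state `u` of the window (`IsWeilGroundState a u`: an `L²`-limit of a normalised
  minimising sequence — with the gap these are exactly the unit bottom eigenvectors `c·ξ`,
  `|c| = 1`) has all the zeros of `û = weilMellin u` on `Re s = 1/2`; equivalently the Fourier
  transform `z ↦ û(1/2 + iz)` has only real zeros. `û` is entire
  (`IsWeilGroundState.differentiable_weilMellin`, proved in the sibling file).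

## Faithfulness notes (for the reviewer)

The Lean statement is the letter's claim (Weil form on a window, minimiser on the `L²(d*u)` unit
sphere, "zeros of the Mellin transform on the critical line", "modulo … the lowest eigenvalue …
is simple and even") in the tree's Bombieri normalisation (`x = e^t`: `∫ φ² du/u = ∫ |g|² dt`,
Mellin in `u` = `weilMellin` in `t`, critical line `Re s = 1/2`); its proof in print is
Connes–van Suijlekom Thm. 6.1 applied to the one-sided distribution on `[0, 2a]` obtained from
Weil's distribution after the shift `t ↦ t + a` (C–vS Rem. 4.3: one-sided, not symmetrised).
Complex-valued ground states are allowed by `IsWeilGroundState`; with a simple bottom they are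
the phase multiples of the real even eigenfunction, with the same zeros. Nothing here asserts that
the hypothesis holds for any `a` (Connes 2026, §6.6: "one needs to show that the smallest
eigenvalue of the Weil quadratic form `QW_λ` is simple with even eigenvector" — open).

## References

* [ConnesSuijlekom2025] A. Connes, W. D. van Suijlekom, Comm. Math. Phys. 406 (2025),
  arXiv:2511.23257: §4 (4.1)–(4.3), Prop. 4.1, Rem. 4.3, Thm. 5.6, Thm. 6.1 (= Thm. 1.2).
* [Connes2026Letter] A. Connes, arXiv:2602.04022: §5 (letter, p. 20), §6.1 Thm. 6.1, §6.6.
* [Bombieri2000Weil] E. Bombieri, Rend. Mat. Acc. Lincei (9) 11 (2000), §4 Problem 2, Thm. 3.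
-/

noncomputable section

open Complex Filter Set MeasureTheory
open scoped Real Topology ComplexConjugate

namespace Literature.NumberTheory.LFunctions

/-! ## The hypothesis: simple, isolated, even bottom of the truncated Weil form -/

-- NOTE (2026-08-16): the hypothesis `WeilWindowSimpleEven a` is DEFINED in
-- `Literature/NumberTheory/LFunctions/WeilWindowSimpleEven.lean` (imported above). It used to be
-- re-declared verbatim here, which made the two modules — and every pair of their importers, e.g. the
-- `SignCone` duality files and the `SignCone` magnification/continuation files — impossible to import
-- together ("environment already contains 'Literature.NumberTheory.LFunctions.WeilWindowSimpleEven'").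
-- The statement is unchanged (same term); `weilWindowSimpleEven_iff` below is still `Iff.rfl`.

/-- Unfolding of `WeilWindowSimpleEven` (it is literally the inline clause of the route
statements). [folklore] -/
theorem weilWindowSimpleEven_iff (a : ℝ) :
    WeilWindowSimpleEven a ↔
      ∃ φ : ℝ → ℂ, ∃ δ : ℝ, 0 < δ ∧ ∀ g : ℝ → ℂ, IsWeilTest g → tsupport g ⊆ Set.Icc (-a) a →
        ∫ t, ‖g t‖ ^ 2 = (1 : ℝ) →
          ((∀ t, g (-t) = -g t) ∨ ((∀ t, g (-t) = g t) ∧ ∫ t, starRingEnd ℂ (φ t) * g t = 0)) →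
            weilGroundEnergy a + δ ≤ (weilQuadratic g).re :=
  Iff.rfl

/-- The odd sector alone: under `WeilWindowSimpleEven a`, odd normalised test functions on the
window have `Re Q ≥ ε(a) + δ` for the gap `δ` (immediate from the definition). [folklore] -/
theorem WeilWindowSimpleEven.exists_gap_odd {a : ℝ} (h : WeilWindowSimpleEven a) :
    ∃ δ : ℝ, 0 < δ ∧ ∀ g : ℝ → ℂ, IsWeilTest g → tsupport g ⊆ Set.Icc (-a) a →
      ∫ t, ‖g t‖ ^ 2 = (1 : ℝ) → (∀ t, g (-t) = -g t) → weilGroundEnergy a + δ ≤ (weilQuadratic g).re := by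
  obtain ⟨φ, δ, hδ, hg⟩ := h
  exact ⟨δ, hδ, fun g h1 h2 h3 hodd => hg g h1 h2 h3 (Or.inl hodd)⟩

/-! ## The named fact -/

/-- **Connes 2026 (§5 letter, §6.1) from Connes–van Suijlekom 2025, Thm. 6.1: if the bottom of the
truncated Weil form is simple and even, the transform of its ground state has all its zeros on the
critical line.** Printed: "I then take the Mellin transform of the function `η(u)` [the minimiser
of Weil's form on the window under `∫ φ² du/u = 1`]. I also know how to prove that the zeros of
this Mellin transform are on the critical line. This is proved modulo a condition of uniqueness of
the minimum [one needs to assume that the lowest eigenvalue of the quadratic form is simple and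
even]", the proof being C–vS Thm. 6.1 ("… the minimum of its spectrum is a simple, isolated
eigenvalue `λ`, with even eigenfunction `ξ`. Then all the zeros of the entire function `ξ̂(z)` …
lie on the real line"). Rendering: for every window `a` with `WeilWindowSimpleEven a` and every
ground state `u` (`IsWeilGroundState a u`), every zero `s` of `weilMellin u` has `Re s = 1/2`
(`weilMellin u (1/2 + iz)` is the Fourier transform in `z`). Statement only.
[cite: Connes2026Letter, §5 (p. 20) and §6.1] [cite: ConnesSuijlekom2025, Thm. 6.1] -/
def Connes2026_weilGroundState_zeros_re_eq_half : Prop :=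
  ∀ (a : ℝ), WeilWindowSimpleEven a → ∀ u : ℝ → ℂ, IsWeilGroundState a u →
    ∀ s : ℂ, weilMellin u s = 0 → s.re = 1 / 2

/-! ## Consequences (proved from the fact) -/

/-- The route form: under the fact, `WeilWindowSimpleEven a` gives, for every ground state `u`,
that `û = weilMellin u` is ENTIRE (proved, `IsWeilGroundState.differentiable_weilMellin`) with all
its zeros on `Re s = 1/2`. [cite: Connes2026Letter, §6.1] -/
theorem Connes2026_weilGroundState_zeros_re_eq_half.differentiable_and_zeros
    (h : Connes2026_weilGroundState_zeros_re_eq_half) {a : ℝ} (ha : WeilWindowSimpleEven a)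
    {u : ℝ → ℂ} (hu : IsWeilGroundState a u) :
    Differentiable ℂ (weilMellin u) ∧ ∀ s : ℂ, weilMellin u s = 0 → s.re = 1 / 2 :=
  ⟨hu.differentiable_weilMellin, h a ha u hu⟩

/-- Fourier form: under the fact, the zeros of `z ↦ û(1/2 + iz)` are real.
[cite: ConnesSuijlekom2025, Thm. 6.1] -/
theorem Connes2026_weilGroundState_zeros_re_eq_half.im_eq_zero_of_fourier_eq_zero
    (h : Connes2026_weilGroundState_zeros_re_eq_half) {a : ℝ} (ha : WeilWindowSimpleEven a)
    {u : ℝ → ℂ} (hu : IsWeilGroundState a u) {z : ℂ}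
    (hz : weilMellin u (1 / 2 + I * z) = 0) : z.im = 0 := by
  have hre := h a ha u hu _ hz
  simp only [add_re, mul_re, I_re, I_im, zero_mul, one_mul, zero_sub] at hre
  norm_num at hre
  linarith

end Literature.NumberTheory.LFunctions
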